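import Summits.ResolutionOfSingularities.ResolutionOfSingularities.Theorems.FrobeniusClosingSteerToricVertexExit
import HarnessLib

/-!
# Crux `Steer` (stmt-ResolutionOfSingularities-16345) — E-ROW #3: the W9′ (and W5′, W13′, W9″, W10, W14e) FIBRE-WIDE `Concl` CERTIFICATES, every
# valuation ring on the fibre «the pin is the unique ν-minimal monomial» (signature of record `D/res-D-brk-2/K_W9_signature.lean`
# 40590a5e08b7c948, theorem `concl_W9_fibre` VERBATIM)

OURS (campaign res-hironaka, rung L ★L-G4, slot W4.1; res-D-brk-2 g6 on res-L0-w41-plan-1 RULING 229 (d)). Candidates, not facts; NOT a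
statement of H. Hironaka's manuscript [claim: Hironaka2017, status: under-review]; AI formalisation, weaker than expert review;
`--supports stmt-ResolutionOfSingularities-16345 --as helper`, counted 0. Definition-free. Datum: res-L0-w41-strat-1 g10 `W9-DATUM.md` v1.1
13a610665a88abbb §1 (the deflation-entry family `W_{4k+1}`, `k = 𝔽₂`, `A₀ = k[x,y,z,u]`, `t² = g`) and §6 («`Concl O A₀ t` is TRUE on W9′ —
toric exit: the pin `x⁴y¹²z` is the UNIQUE ν-minimal monomial of `g`»).

## What is proved (any fields `k ⊆ K`, NO characteristic hypothesis, NO weight ray fixed)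

For every valuation ring `O ⊇ k` of `K` with `x, y, z, u ∈ O ∖ 0`, `k(x,y,z,u,t) = K`, `trdeg_k K = 4`:
* `concl_W9_fibre` — `t² = x⁵ + x⁴y¹²z + u⁴¹ + z³u³⁸ + z⁹u³²` and the pin `x⁴y¹²z` of strictly larger `O.valuation` (= strictly SMALLER
  value) than each of `x⁵, u⁴¹, z³u³⁸, z⁹u³²` ⟹ `Concl O k[x,y,z,u] t`;
* `concl_W5_fibre` — the member `k = 1`: `t² = x³ + x²y⁶z + u¹³ + z³u¹⁰ + z⁵u⁸`, pin `x²y⁶z`;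
* `concl_W13_fibre` — the member `k = 3`: `t² = x⁷ + x⁶y¹⁸z + x⁴y¹²z⁵u²⁴ + x²y⁶z⁹u⁴⁸ + z¹³u⁷² + u⁸⁵ + z³u⁸²`, pin `x⁶y¹⁸z`;
* `concl_W9b_fibre` (W9″, re-tuned against `𝔽₈`), `concl_W10_fibre`, `concl_W14e_fibre` — strat-1's W10-DATUM v1.0 §1 data (odd and
  EVEN-tail deflation entries), pins `x⁴y¹²z`, `x⁴y¹³z`, `x⁶y¹⁹z`.
* `trdeg_eq_of_sq_mem` / `concl_of_dominant_monomial_of_algebraicIndependent` / `concl_W9_fibre_of_algebraicIndependent` — the same with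
  the datum's own hypothesis «letters algebraically independent over `k`» (W9-DATUM §4 binder 1) in place of `trdeg_k K = 4`.
All six are ONE-LINE instances of the general theorem `SteerToricVertexExit.concl_of_dominant_monomial` (toric exit at a dominant
vertex with an odd exponent — here the `z`-exponent `1` — along ANY valuation: Perron pair blow-ups decided by `O`, odd-support reduction,
one Jacobian chart). Scope said plainly: this certifies ONLY the `Concl` clause for these data (so W9′ inhabits hK4ᶜᴵ/Dropᴵ∨'s antecedent
as a NON-VACUITY witness with `Concl` TRUE, W9-DATUM §4/§6); the run-side clauses are strat-1's engine readings and are NOT typed here.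
[cite: Teissier2014] [folklore]
-/

noncomputable section

-- single-problem summit: the doubled namespace component `ResolutionOfSingularities` is forced
set_option linter.dupNamespace false

open scoped BigOperators

namespace Summit.ResolutionOfSingularities.ResolutionOfSingularities.Theorems.SteerW9Witness

open Summit.ResolutionOfSingularities.ResolutionOfSingularities.Theorems.SteerToricVertexExit

variable {k K : Type} [Field k] [Field K] [Algebra k K]

omit [Field K] [Algebra k K] in
/-- The range of a four-letter vector. [folklore] -/
theorem range_vec4 (x y z u : K) : Set.range ![x, y, z, u] = ({x, y, z, u} : Set K) := by
  ext w
  simp only [Set.mem_range, Set.mem_insert_iff, Set.mem_singleton_iff]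
  constructor
  · rintro ⟨i, rfl⟩
    fin_cases i <;> simp
  · rintro (rfl | rfl | rfl | rfl)
    · exact ⟨0, rfl⟩
    · exact ⟨1, rfl⟩
    · exact ⟨2, rfl⟩
    · exact ⟨3, rfl⟩

/-- Field generation by the four letters and `t`, in the general theorem's format. [folklore] -/
theorem adjoin_insert_range_vec4 (x y z u t : K) (hgen : IntermediateField.adjoin k ({x, y, z, u, t} : Set K) = ⊤) :
    IntermediateField.adjoin k (insert t (Set.range ![x, y, z, u])) = ⊤ := by
  rw [range_vec4]
  have e : (insert t ({x, y, z, u} : Set K)) = ({x, y, z, u, t} : Set K) := by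
    ext w
    simp only [Set.mem_insert_iff, Set.mem_singleton_iff]
    tauto
  rw [e, hgen]

/-- The four letters as a vector: non-vanishing. [folklore] -/
theorem vec4_ne_zero {x y z u : K} (hx : x ≠ 0) (hy : y ≠ 0) (hz : z ≠ 0) (hu : u ≠ 0) : ∀ j, ![x, y, z, u] j ≠ 0 := by
  intro j; fin_cases j <;> assumption

/-- The four letters as a vector: membership in `O`. [folklore] -/
theorem vec4_mem (O : ValuationSubring K) {x y z u : K} (hx : x ∈ O) (hy : y ∈ O) (hz : z ∈ O) (hu : u ∈ O) :
    ∀ j, ![x, y, z, u] j ∈ O := by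
  intro j; fin_cases j <;> assumption

/-- **E-ROW #3 · W9′ fibre-wide `Concl` witness**: for every valuation ring `O ⊇ k` of `K = k(x,y,z,u,t)`,
`t² = x⁵ + x⁴y¹²z + u⁴¹ + z³u³⁸ + z⁹u³²`, `trdeg_k K = 4`, with `x, y, z, u ∈ O ∖ 0` and the pin `x⁴y¹²z` the UNIQUE ν-minimal monomial
(multiplicatively: the other four monomials have strictly smaller `O.valuation`), `Concl O k[x,y,z,u] t` holds. OURS. [folklore] -/
theorem concl_W9_fibre (O : ValuationSubring K) (hk : ∀ c : k, algebraMap k K c ∈ O) (x y z u t : K)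
    (hxO : x ∈ O) (hyO : y ∈ O) (hzO : z ∈ O) (huO : u ∈ O) (hx : x ≠ 0) (hy : y ≠ 0) (hz : z ≠ 0) (hu : u ≠ 0)
    (ht : t ^ 2 = x ^ 5 + x ^ 4 * y ^ 12 * z + u ^ 41 + z ^ 3 * u ^ 38 + z ^ 9 * u ^ 32)
    (hgen : IntermediateField.adjoin k ({x, y, z, u, t} : Set K) = ⊤) (htr : Algebra.trdeg k K = 4)
    (h1 : O.valuation (x ^ 5) < O.valuation (x ^ 4 * y ^ 12 * z))
    (h2 : O.valuation (u ^ 41) < O.valuation (x ^ 4 * y ^ 12 * z))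
    (h3 : O.valuation (z ^ 3 * u ^ 38) < O.valuation (x ^ 4 * y ^ 12 * z))
    (h4 : O.valuation (z ^ 9 * u ^ 32) < O.valuation (x ^ 4 * y ^ 12 * z)) :
    SwitchingDichotomy.Words.Concl O (Algebra.adjoin k ({x, y, z, u} : Set K)) t := by
  classical
  -- exponent table: row 0 = the pin `x⁴y¹²z`, then `x⁵, u⁴¹, z³u³⁸, z⁹u³²`
  let E : Fin 5 → Fin 4 → ℕ := ![![4, 12, 1, 0], ![5, 0, 0, 0], ![0, 0, 0, 41], ![0, 0, 3, 38], ![0, 0, 9, 32]]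
  have hE : ∀ i, (∏ j, ![x, y, z, u] j ^ E i j) = ![x ^ 4 * y ^ 12 * z, x ^ 5, u ^ 41, z ^ 3 * u ^ 38, z ^ 9 * u ^ 32] i := by
    intro i
    fin_cases i <;> simp [E, Fin.prod_univ_four]
  have ht' : t ^ 2 = ∑ i, algebraMap k K ((fun _ => (1 : k)) i) * ∏ j, ![x, y, z, u] j ^ E i j := by
    simp only [hE, map_one, one_mul, Fin.sum_univ_five]
    simp only [Matrix.cons_val_zero, Matrix.cons_val_one, Matrix.cons_val_two, Matrix.cons_val_three, Matrix.cons_val_four,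
      Matrix.head_cons, Matrix.tail_cons]
    rw [ht]; ring
  have hdom : ∀ i, i ≠ 0 → O.valuation (∏ j, ![x, y, z, u] j ^ E i j) < O.valuation (∏ j, ![x, y, z, u] j ^ E 0 j) := by
    intro i hi
    rw [hE, hE]
    fin_cases i
    · exact absurd rfl hi
    · simpa using h1
    · simpa using h2
    · simpa using h3
    · simpa using h4
  have h := concl_of_dominant_monomial O hk ![x, y, z, u] (vec4_ne_zero hx hy hz hu) (vec4_mem O hxO hyO hzO huO) t
    (fun _ => (1 : k)) one_ne_zero E ⟨2, by simp [E]⟩ ht' hdom (adjoin_insert_range_vec4 x y z u t hgen) htr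
  rwa [range_vec4] at h

/-- **W5′ fibre-wide `Concl` witness** (the member `k = 1` of the family): `t² = x³ + x²y⁶z + u¹³ + z³u¹⁰ + z⁵u⁸`, pin `x²y⁶z` the
unique ν-minimal monomial ⟹ `Concl O k[x,y,z,u] t`. OURS. [folklore] -/
theorem concl_W5_fibre (O : ValuationSubring K) (hk : ∀ c : k, algebraMap k K c ∈ O) (x y z u t : K)
    (hxO : x ∈ O) (hyO : y ∈ O) (hzO : z ∈ O) (huO : u ∈ O) (hx : x ≠ 0) (hy : y ≠ 0) (hz : z ≠ 0) (hu : u ≠ 0)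
    (ht : t ^ 2 = x ^ 3 + x ^ 2 * y ^ 6 * z + u ^ 13 + z ^ 3 * u ^ 10 + z ^ 5 * u ^ 8)
    (hgen : IntermediateField.adjoin k ({x, y, z, u, t} : Set K) = ⊤) (htr : Algebra.trdeg k K = 4)
    (h1 : O.valuation (x ^ 3) < O.valuation (x ^ 2 * y ^ 6 * z))
    (h2 : O.valuation (u ^ 13) < O.valuation (x ^ 2 * y ^ 6 * z))
    (h3 : O.valuation (z ^ 3 * u ^ 10) < O.valuation (x ^ 2 * y ^ 6 * z))
    (h4 : O.valuation (z ^ 5 * u ^ 8) < O.valuation (x ^ 2 * y ^ 6 * z)) :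
    SwitchingDichotomy.Words.Concl O (Algebra.adjoin k ({x, y, z, u} : Set K)) t := by
  classical
  let E : Fin 5 → Fin 4 → ℕ := ![![2, 6, 1, 0], ![3, 0, 0, 0], ![0, 0, 0, 13], ![0, 0, 3, 10], ![0, 0, 5, 8]]
  have hE : ∀ i, (∏ j, ![x, y, z, u] j ^ E i j) = ![x ^ 2 * y ^ 6 * z, x ^ 3, u ^ 13, z ^ 3 * u ^ 10, z ^ 5 * u ^ 8] i := by
    intro i
    fin_cases i <;> simp [E, Fin.prod_univ_four]
  have ht' : t ^ 2 = ∑ i, algebraMap k K ((fun _ => (1 : k)) i) * ∏ j, ![x, y, z, u] j ^ E i j := by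
    simp only [hE, map_one, one_mul, Fin.sum_univ_five]
    simp only [Matrix.cons_val_zero, Matrix.cons_val_one, Matrix.cons_val_two, Matrix.cons_val_three, Matrix.cons_val_four,
      Matrix.head_cons, Matrix.tail_cons]
    rw [ht]; ring
  have hdom : ∀ i, i ≠ 0 → O.valuation (∏ j, ![x, y, z, u] j ^ E i j) < O.valuation (∏ j, ![x, y, z, u] j ^ E 0 j) := by
    intro i hi
    rw [hE, hE]
    fin_cases i
    · exact absurd rfl hi
    · simpa using h1
    · simpa using h2
    · simpa using h3
    · simpa using h4
  have h := concl_of_dominant_monomial O hk ![x, y, z, u] (vec4_ne_zero hx hy hz hu) (vec4_mem O hxO hyO hzO huO) t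
    (fun _ => (1 : k)) one_ne_zero E ⟨2, by simp [E]⟩ ht' hdom (adjoin_insert_range_vec4 x y z u t hgen) htr
  rwa [range_vec4] at h

/-- **W13′ fibre-wide `Concl` witness** (the member `k = 3`): `t² = x⁷ + x⁶y¹⁸z + x⁴y¹²z⁵u²⁴ + x²y⁶z⁹u⁴⁸ + z¹³u⁷² + u⁸⁵ + z³u⁸²`,
pin `x⁶y¹⁸z` the unique ν-minimal monomial ⟹ `Concl O k[x,y,z,u] t`. OURS. [folklore] -/
theorem concl_W13_fibre (O : ValuationSubring K) (hk : ∀ c : k, algebraMap k K c ∈ O) (x y z u t : K)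
    (hxO : x ∈ O) (hyO : y ∈ O) (hzO : z ∈ O) (huO : u ∈ O) (hx : x ≠ 0) (hy : y ≠ 0) (hz : z ≠ 0) (hu : u ≠ 0)
    (ht : t ^ 2 = x ^ 7 + x ^ 6 * y ^ 18 * z + x ^ 4 * y ^ 12 * z ^ 5 * u ^ 24 + x ^ 2 * y ^ 6 * z ^ 9 * u ^ 48 +
      z ^ 13 * u ^ 72 + u ^ 85 + z ^ 3 * u ^ 82)
    (hgen : IntermediateField.adjoin k ({x, y, z, u, t} : Set K) = ⊤) (htr : Algebra.trdeg k K = 4)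
    (h1 : O.valuation (x ^ 7) < O.valuation (x ^ 6 * y ^ 18 * z))
    (h2 : O.valuation (x ^ 4 * y ^ 12 * z ^ 5 * u ^ 24) < O.valuation (x ^ 6 * y ^ 18 * z))
    (h3 : O.valuation (x ^ 2 * y ^ 6 * z ^ 9 * u ^ 48) < O.valuation (x ^ 6 * y ^ 18 * z))
    (h4 : O.valuation (z ^ 13 * u ^ 72) < O.valuation (x ^ 6 * y ^ 18 * z))
    (h5 : O.valuation (u ^ 85) < O.valuation (x ^ 6 * y ^ 18 * z))
    (h6 : O.valuation (z ^ 3 * u ^ 82) < O.valuation (x ^ 6 * y ^ 18 * z)) :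
    SwitchingDichotomy.Words.Concl O (Algebra.adjoin k ({x, y, z, u} : Set K)) t := by
  classical
  let E : Fin 7 → Fin 4 → ℕ :=
    ![![6, 18, 1, 0], ![7, 0, 0, 0], ![4, 12, 5, 24], ![2, 6, 9, 48], ![0, 0, 13, 72], ![0, 0, 0, 85], ![0, 0, 3, 82]]
  have hE : ∀ i, (∏ j, ![x, y, z, u] j ^ E i j) =
      ![x ^ 6 * y ^ 18 * z, x ^ 7, x ^ 4 * y ^ 12 * z ^ 5 * u ^ 24, x ^ 2 * y ^ 6 * z ^ 9 * u ^ 48, z ^ 13 * u ^ 72, u ^ 85,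
        z ^ 3 * u ^ 82] i := by
    intro i
    fin_cases i <;> simp [E, Fin.prod_univ_four]
  have ht' : t ^ 2 = ∑ i, algebraMap k K ((fun _ => (1 : k)) i) * ∏ j, ![x, y, z, u] j ^ E i j := by
    simp only [hE, map_one, one_mul, Fin.sum_univ_seven]
    simp only [Matrix.cons_val_zero, Matrix.cons_val_one, Matrix.cons_val_two, Matrix.cons_val_three, Matrix.cons_val_four,
      Matrix.cons_val, Matrix.head_cons, Matrix.tail_cons]
    rw [ht]; ring
  have hdom : ∀ i, i ≠ 0 → O.valuation (∏ j, ![x, y, z, u] j ^ E i j) < O.valuation (∏ j, ![x, y, z, u] j ^ E 0 j) := by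
    intro i hi
    rw [hE, hE]
    fin_cases i
    · exact absurd rfl hi
    · simpa using h1
    · simpa using h2
    · simpa using h3
    · simpa using h4
    · simpa using h5
    · simpa using h6
  have h := concl_of_dominant_monomial O hk ![x, y, z, u] (vec4_ne_zero hx hy hz hu) (vec4_mem O hxO hyO hzO huO) t
    (fun _ => (1 : k)) one_ne_zero E ⟨2, by simp [E]⟩ ht' hdom (adjoin_insert_range_vec4 x y z u t hgen) htr
  rwa [range_vec4] at h

/-- **W9″ fibre-wide `Concl` witness** (W9′ re-tuned against `𝔽₈`, strat-1 W10-DATUM v1.0 §1 (C3)): `t² = x⁵ + x⁴y¹²z + u⁴¹ + z⁵u³⁶ + z⁹u³²`,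
pin `x⁴y¹²z` the unique ν-minimal monomial ⟹ `Concl O k[x,y,z,u] t`. OURS. [folklore] -/
theorem concl_W9b_fibre (O : ValuationSubring K) (hk : ∀ c : k, algebraMap k K c ∈ O) (x y z u t : K)
    (hxO : x ∈ O) (hyO : y ∈ O) (hzO : z ∈ O) (huO : u ∈ O) (hx : x ≠ 0) (hy : y ≠ 0) (hz : z ≠ 0) (hu : u ≠ 0)
    (ht : t ^ 2 = x ^ 5 + x ^ 4 * y ^ 12 * z + u ^ 41 + z ^ 5 * u ^ 36 + z ^ 9 * u ^ 32)
    (hgen : IntermediateField.adjoin k ({x, y, z, u, t} : Set K) = ⊤) (htr : Algebra.trdeg k K = 4)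
    (h1 : O.valuation (x ^ 5) < O.valuation (x ^ 4 * y ^ 12 * z))
    (h2 : O.valuation (u ^ 41) < O.valuation (x ^ 4 * y ^ 12 * z))
    (h3 : O.valuation (z ^ 5 * u ^ 36) < O.valuation (x ^ 4 * y ^ 12 * z))
    (h4 : O.valuation (z ^ 9 * u ^ 32) < O.valuation (x ^ 4 * y ^ 12 * z)) :
    SwitchingDichotomy.Words.Concl O (Algebra.adjoin k ({x, y, z, u} : Set K)) t := by
  classical
  let E : Fin 5 → Fin 4 → ℕ := ![![4, 12, 1, 0], ![5, 0, 0, 0], ![0, 0, 0, 41], ![0, 0, 5, 36], ![0, 0, 9, 32]]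
  have hE : ∀ i, (∏ j, ![x, y, z, u] j ^ E i j) = ![x ^ 4 * y ^ 12 * z, x ^ 5, u ^ 41, z ^ 5 * u ^ 36, z ^ 9 * u ^ 32] i := by
    intro i
    fin_cases i <;> simp [E, Fin.prod_univ_four]
  have ht' : t ^ 2 = ∑ i, algebraMap k K ((fun _ => (1 : k)) i) * ∏ j, ![x, y, z, u] j ^ E i j := by
    simp only [hE, map_one, one_mul, Fin.sum_univ_five]
    simp only [Matrix.cons_val_zero, Matrix.cons_val_one, Matrix.cons_val_two, Matrix.cons_val_three, Matrix.cons_val_four,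
      Matrix.head_cons, Matrix.tail_cons]
    rw [ht]; ring
  have hdom : ∀ i, i ≠ 0 → O.valuation (∏ j, ![x, y, z, u] j ^ E i j) < O.valuation (∏ j, ![x, y, z, u] j ^ E 0 j) := by
    intro i hi
    rw [hE, hE]
    fin_cases i
    · exact absurd rfl hi
    · simpa using h1
    · simpa using h2
    · simpa using h3
    · simpa using h4
  have h := concl_of_dominant_monomial O hk ![x, y, z, u] (vec4_ne_zero hx hy hz hu) (vec4_mem O hxO hyO hzO huO) t
    (fun _ => (1 : k)) one_ne_zero E ⟨2, by simp [E]⟩ ht' hdom (adjoin_insert_range_vec4 x y z u t hgen) htr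
  rwa [range_vec4] at h

/-- **W10 fibre-wide `Concl` witness** (the EVEN-tail member, strat-1 W10-DATUM v1.0 §1): `t² = x⁵ + x⁴y¹³z + zu⁴¹ + z⁵u³⁷ + z⁹u³³`,
pin `x⁴y¹³z` the unique ν-minimal monomial ⟹ `Concl O k[x,y,z,u] t`. OURS. [folklore] -/
theorem concl_W10_fibre (O : ValuationSubring K) (hk : ∀ c : k, algebraMap k K c ∈ O) (x y z u t : K)
    (hxO : x ∈ O) (hyO : y ∈ O) (hzO : z ∈ O) (huO : u ∈ O) (hx : x ≠ 0) (hy : y ≠ 0) (hz : z ≠ 0) (hu : u ≠ 0)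
    (ht : t ^ 2 = x ^ 5 + x ^ 4 * y ^ 13 * z + z * u ^ 41 + z ^ 5 * u ^ 37 + z ^ 9 * u ^ 33)
    (hgen : IntermediateField.adjoin k ({x, y, z, u, t} : Set K) = ⊤) (htr : Algebra.trdeg k K = 4)
    (h1 : O.valuation (x ^ 5) < O.valuation (x ^ 4 * y ^ 13 * z))
    (h2 : O.valuation (z * u ^ 41) < O.valuation (x ^ 4 * y ^ 13 * z))
    (h3 : O.valuation (z ^ 5 * u ^ 37) < O.valuation (x ^ 4 * y ^ 13 * z))
    (h4 : O.valuation (z ^ 9 * u ^ 33) < O.valuation (x ^ 4 * y ^ 13 * z)) :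
    SwitchingDichotomy.Words.Concl O (Algebra.adjoin k ({x, y, z, u} : Set K)) t := by
  classical
  let E : Fin 5 → Fin 4 → ℕ := ![![4, 13, 1, 0], ![5, 0, 0, 0], ![0, 0, 1, 41], ![0, 0, 5, 37], ![0, 0, 9, 33]]
  have hE : ∀ i, (∏ j, ![x, y, z, u] j ^ E i j) = ![x ^ 4 * y ^ 13 * z, x ^ 5, z * u ^ 41, z ^ 5 * u ^ 37, z ^ 9 * u ^ 33] i := by
    intro i
    fin_cases i <;> simp [E, Fin.prod_univ_four]
  have ht' : t ^ 2 = ∑ i, algebraMap k K ((fun _ => (1 : k)) i) * ∏ j, ![x, y, z, u] j ^ E i j := by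
    simp only [hE, map_one, one_mul, Fin.sum_univ_five]
    simp only [Matrix.cons_val_zero, Matrix.cons_val_one, Matrix.cons_val_two, Matrix.cons_val_three, Matrix.cons_val_four,
      Matrix.head_cons, Matrix.tail_cons]
    rw [ht]; ring
  have hdom : ∀ i, i ≠ 0 → O.valuation (∏ j, ![x, y, z, u] j ^ E i j) < O.valuation (∏ j, ![x, y, z, u] j ^ E 0 j) := by
    intro i hi
    rw [hE, hE]
    fin_cases i
    · exact absurd rfl hi
    · simpa using h1
    · simpa using h2
    · simpa using h3
    · simpa using h4
  have h := concl_of_dominant_monomial O hk ![x, y, z, u] (vec4_ne_zero hx hy hz hu) (vec4_mem O hxO hyO hzO huO) t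
    (fun _ => (1 : k)) one_ne_zero E ⟨2, by simp [E]⟩ ht' hdom (adjoin_insert_range_vec4 x y z u t hgen) htr
  rwa [range_vec4] at h

/-- **W14e fibre-wide `Concl` witness** (EVEN-tail member `m = 3`, strat-1 W10-DATUM v1.0 §1):
`t² = x⁷ + x⁶y¹⁹z + z¹³u⁷³ + z¹¹u⁷⁵ + z⁷u⁷⁹ + z³u⁸³ + zu⁸⁵`, pin `x⁶y¹⁹z` the unique ν-minimal monomial ⟹ `Concl O k[x,y,z,u] t`. OURS.
[folklore] -/
theorem concl_W14e_fibre (O : ValuationSubring K) (hk : ∀ c : k, algebraMap k K c ∈ O) (x y z u t : K)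
    (hxO : x ∈ O) (hyO : y ∈ O) (hzO : z ∈ O) (huO : u ∈ O) (hx : x ≠ 0) (hy : y ≠ 0) (hz : z ≠ 0) (hu : u ≠ 0)
    (ht : t ^ 2 = x ^ 7 + x ^ 6 * y ^ 19 * z + z ^ 13 * u ^ 73 + z ^ 11 * u ^ 75 + z ^ 7 * u ^ 79 + z ^ 3 * u ^ 83 + z * u ^ 85)
    (hgen : IntermediateField.adjoin k ({x, y, z, u, t} : Set K) = ⊤) (htr : Algebra.trdeg k K = 4)
    (h1 : O.valuation (x ^ 7) < O.valuation (x ^ 6 * y ^ 19 * z))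
    (h2 : O.valuation (z ^ 13 * u ^ 73) < O.valuation (x ^ 6 * y ^ 19 * z))
    (h3 : O.valuation (z ^ 11 * u ^ 75) < O.valuation (x ^ 6 * y ^ 19 * z))
    (h4 : O.valuation (z ^ 7 * u ^ 79) < O.valuation (x ^ 6 * y ^ 19 * z))
    (h5 : O.valuation (z ^ 3 * u ^ 83) < O.valuation (x ^ 6 * y ^ 19 * z))
    (h6 : O.valuation (z * u ^ 85) < O.valuation (x ^ 6 * y ^ 19 * z)) :
    SwitchingDichotomy.Words.Concl O (Algebra.adjoin k ({x, y, z, u} : Set K)) t := by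
  classical
  let E : Fin 7 → Fin 4 → ℕ :=
    ![![6, 19, 1, 0], ![7, 0, 0, 0], ![0, 0, 13, 73], ![0, 0, 11, 75], ![0, 0, 7, 79], ![0, 0, 3, 83], ![0, 0, 1, 85]]
  have hE : ∀ i, (∏ j, ![x, y, z, u] j ^ E i j) =
      ![x ^ 6 * y ^ 19 * z, x ^ 7, z ^ 13 * u ^ 73, z ^ 11 * u ^ 75, z ^ 7 * u ^ 79, z ^ 3 * u ^ 83, z * u ^ 85] i := by
    intro i
    fin_cases i <;> simp [E, Fin.prod_univ_four]
  have ht' : t ^ 2 = ∑ i, algebraMap k K ((fun _ => (1 : k)) i) * ∏ j, ![x, y, z, u] j ^ E i j := by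
    simp only [hE, map_one, one_mul, Fin.sum_univ_seven]
    simp only [Matrix.cons_val_zero, Matrix.cons_val_one, Matrix.cons_val_two, Matrix.cons_val_three, Matrix.cons_val_four,
      Matrix.cons_val, Matrix.head_cons, Matrix.tail_cons]
    rw [ht]; ring
  have hdom : ∀ i, i ≠ 0 → O.valuation (∏ j, ![x, y, z, u] j ^ E i j) < O.valuation (∏ j, ![x, y, z, u] j ^ E 0 j) := by
    intro i hi
    rw [hE, hE]
    fin_cases i
    · exact absurd rfl hi
    · simpa using h1
    · simpa using h2
    · simpa using h3
    · simpa using h4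
    · simpa using h5
    · simpa using h6
  have h := concl_of_dominant_monomial O hk ![x, y, z, u] (vec4_ne_zero hx hy hz hu) (vec4_mem O hxO hyO hzO huO) t
    (fun _ => (1 : k)) one_ne_zero E ⟨2, by simp [E]⟩ ht' hdom (adjoin_insert_range_vec4 x y z u t hgen) htr
  rwa [range_vec4] at h

/-! ## Transcendence degree from algebraic independence (the datum's own hypothesis) -/

/-- **`trdeg_k K = n` from an algebraically independent `y` and `t² ∈ k[y]`, `k(y, t) = K`** (general; the argument of K-HW1's
`cardinalMk_eq_trdeg`, letters and radicand arbitrary). [folklore] -/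
theorem trdeg_eq_of_sq_mem {n : ℕ} (y : Fin n → K) (hy : AlgebraicIndependent k y) (t : K)
    (ht : t ^ 2 ∈ Algebra.adjoin k (Set.range y)) (hK : IntermediateField.adjoin k (insert t (Set.range y)) = ⊤) :
    Algebra.trdeg k K = n := by
  classical
  have htop : ∀ x : K, x ∈ IntermediateField.adjoin k (insert t (Set.range y)) := fun x => by
    rw [hK]; exact IntermediateField.mem_top
  have halg : Algebra.IsAlgebraic (Algebra.adjoin k (Set.range y)) K := by
    let T : Subfield K :=
      { (Subalgebra.algebraicClosure (Algebra.adjoin k (Set.range y)) K).toSubring with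
        inv_mem' := fun x hx => IsAlgebraic.inv hx }
    have hT : ∀ x : K, x ∈ T ↔ IsAlgebraic (Algebra.adjoin k (Set.range y)) x := fun x => Iff.rfl
    have hgen : (IntermediateField.adjoin k (insert t (Set.range y))).toSubfield ≤ T := by
      rw [IntermediateField.adjoin_toSubfield]
      refine Subfield.closure_le.mpr ?_
      rintro x (⟨c, rfl⟩ | rfl | ⟨i, rfl⟩)
      · rw [SetLike.mem_coe, hT, IsScalarTower.algebraMap_apply k (Algebra.adjoin k (Set.range y)) K c]
        exact isAlgebraic_algebraMap _
      · rw [SetLike.mem_coe, hT]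
        refine ⟨Polynomial.X ^ 2 - Polynomial.C ⟨_, ht⟩, Polynomial.X_pow_sub_C_ne_zero two_pos _, ?_⟩
        rw [map_sub, map_pow, Polynomial.aeval_X, Polynomial.aeval_C]
        exact sub_self _
      · rw [SetLike.mem_coe, hT]
        exact isAlgebraic_algebraMap (⟨y i, Algebra.subset_adjoin ⟨i, rfl⟩⟩ : Algebra.adjoin k (Set.range y))
    exact ⟨fun x => (hT x).mp (hgen ((IntermediateField.mem_toSubfield _ _).mpr (htop x)))⟩
  have hbasis : IsTranscendenceBasis k y := (AlgebraicIndependent.isTranscendenceBasis_iff_isAlgebraic hy).mpr halg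
  rw [← hbasis.cardinalMk_eq_trdeg, Cardinal.mk_fin]

/-- **The general theorem with the datum's own hypothesis** «the letters are algebraically independent over `k`» in place of
`trdeg_k K = n` (`t² ∈ k[y]` makes `y` a transcendence basis). OURS. [folklore] -/
theorem concl_of_dominant_monomial_of_algebraicIndependent (O : ValuationSubring K) (hk : ∀ c : k, algebraMap k K c ∈ O)
    {n m : ℕ} (y : Fin n → K) (hy : AlgebraicIndependent k y) (hyO : ∀ j, y j ∈ O) (t : K)
    (c : Fin (m + 1) → k) (hc0 : c 0 ≠ 0) (E : Fin (m + 1) → Fin n → ℕ) (hodd : ∃ j, Odd (E 0 j))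
    (ht : t ^ 2 = ∑ i, algebraMap k K (c i) * ∏ j, y j ^ E i j)
    (hdom : ∀ i, i ≠ 0 → O.valuation (∏ j, y j ^ E i j) < O.valuation (∏ j, y j ^ E 0 j))
    (hgen : IntermediateField.adjoin k (insert t (Set.range y)) = ⊤) :
    SwitchingDichotomy.Words.Concl O (Algebra.adjoin k (Set.range y)) t := by
  have hsq : t ^ 2 ∈ Algebra.adjoin k (Set.range y) := by
    rw [ht]
    refine Subalgebra.sum_mem _ fun i _ => Subalgebra.mul_mem _ (Subalgebra.algebraMap_mem _ _) ?_
    exact Subalgebra.prod_mem _ fun j _ => Subalgebra.pow_mem _ (Algebra.subset_adjoin (Set.mem_range_self j)) _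
  exact concl_of_dominant_monomial O hk y (fun j => hy.ne_zero j) hyO t c hc0 E hodd ht hdom hgen
    (trdeg_eq_of_sq_mem y hy t hsq hgen)

/-- **W9′ with algebraic independence** (strat-1's recipe: `x, y, z, u` algebraically independent over `k`, W9-DATUM §4 binder 1) in place of
`trdeg_k K = 4` and `x, y, z, u ≠ 0`. OURS. [folklore] -/
theorem concl_W9_fibre_of_algebraicIndependent (O : ValuationSubring K) (hk : ∀ c : k, algebraMap k K c ∈ O) (x y z u t : K)
    (hind : AlgebraicIndependent k ![x, y, z, u]) (hxO : x ∈ O) (hyO : y ∈ O) (hzO : z ∈ O) (huO : u ∈ O)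
    (ht : t ^ 2 = x ^ 5 + x ^ 4 * y ^ 12 * z + u ^ 41 + z ^ 3 * u ^ 38 + z ^ 9 * u ^ 32)
    (hgen : IntermediateField.adjoin k ({x, y, z, u, t} : Set K) = ⊤)
    (h1 : O.valuation (x ^ 5) < O.valuation (x ^ 4 * y ^ 12 * z))
    (h2 : O.valuation (u ^ 41) < O.valuation (x ^ 4 * y ^ 12 * z))
    (h3 : O.valuation (z ^ 3 * u ^ 38) < O.valuation (x ^ 4 * y ^ 12 * z))
    (h4 : O.valuation (z ^ 9 * u ^ 32) < O.valuation (x ^ 4 * y ^ 12 * z)) :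
    SwitchingDichotomy.Words.Concl O (Algebra.adjoin k ({x, y, z, u} : Set K)) t := by
  have hsq : t ^ 2 ∈ Algebra.adjoin k (Set.range ![x, y, z, u]) := by
    rw [range_vec4, ht]
    have hm : ∀ w ∈ ({x, y, z, u} : Set K), w ∈ Algebra.adjoin k ({x, y, z, u} : Set K) := fun w hw => Algebra.subset_adjoin hw
    have hx' := hm x (by simp); have hy' := hm y (by simp); have hz' := hm z (by simp); have hu' := hm u (by simp)
    refine Subalgebra.add_mem _ (Subalgebra.add_mem _ (Subalgebra.add_mem _ (Subalgebra.add_mem _ (Subalgebra.pow_mem _ hx' 5)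
      (Subalgebra.mul_mem _ (Subalgebra.mul_mem _ (Subalgebra.pow_mem _ hx' 4) (Subalgebra.pow_mem _ hy' 12)) hz'))
      (Subalgebra.pow_mem _ hu' 41)) (Subalgebra.mul_mem _ (Subalgebra.pow_mem _ hz' 3) (Subalgebra.pow_mem _ hu' 38)))
      (Subalgebra.mul_mem _ (Subalgebra.pow_mem _ hz' 9) (Subalgebra.pow_mem _ hu' 32))
  exact concl_W9_fibre O hk x y z u t hxO hyO hzO huO (hind.ne_zero 0) (hind.ne_zero 1) (hind.ne_zero 2) (hind.ne_zero 3) ht hgen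
    (trdeg_eq_of_sq_mem _ hind t hsq (adjoin_insert_range_vec4 x y z u t hgen)) h1 h2 h3 h4

end Summit.ResolutionOfSingularities.ResolutionOfSingularities.Theorems.SteerW9Witness

end
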